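import Literature.Computability.MetaComplexity.AvgCaseDerandomizationBFP
import Literature.Computability.MetaComplexity.AvgCaseMADerandomization
import Literature.Computability.Complexity.PromiseMAScaling
import Literature.Computability.Complexity.PCPCircuitArthur
import Literature.Computability.Complexity.CircuitSizeProofs
import Literature.Computability.Complexity.ProbabilisticClassesProofs
import Literature.Computability.Complexity.CountingHierarchyProofs
import Literature.Computability.Complexity.FPStringBricks
import Literature.Computability.Complexity.HashBricks
import Literature.Computability.Complexity.LengthCompare
import Mathlib.Analysis.SpecificLimits.Normed
import HarnessLib

/-!
# Buhrman–Fortnow–Pavan, Lemma 3.7 (hence Thm. 3.1) from probabilistically checkable proofs for `E` (their Thm. 3.3)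

Fourth proof file of `AvgCaseDerandomization.lean` (the named fact
`BuhrmanFortnowPavan2004_PromiseBPP'_subset_PromiseP`, BFP Thm. 3.1 in promise form).
`AvgCaseDerandomizationBFP.lean` reduced the fact to BFP's **Lemma 3.7** (`h37`: under
`DistNP ⊆ AvgP`, if every language in `E` has `2^{εn}`-size circuits infinitely often for every
`ε > 0`, then every `A ∈ E` agrees with some `B ∈ NTIME(2ⁿ)` at infinitely many lengths). The printed
proof of Lemma 3.7 (BFP, authors' version pp. 4–6) has three ingredients:

1. **Theorem 3.3 (BFLS–PS)** — "given the computational path of a nondeterministic machine using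
   time `t(n)`, there exists a probabilistically checkable proof of this computation computable in
   time `t^{1+ε}(n)` and probabilistically verifiable in time `log^{O(1/ε)} t(n)`" [BFLS91, PS94];
2. **Lemma 3.4** — from Thm. 3.3 and the infinitely-often small circuits: "Merlin just sends over this
   circuit and Arthur probabilistically verifies this proof in time polynomial in `n` with random
   access to the proof which he can simulate by evaluating the circuit" (a Merlin–Arthur protocol for
   `A` at infinitely many lengths);
3. the Köbler–Schuler derandomisation of that protocol from a certified hard truth table
   (`pr-MA ⊆ pr-NP` under the average-case hypothesis) scaled to exponential-time Arthurs.

Item 3 is in the tree (`PromiseMA'_subset_PromiseNP_of_uniform`, `AvgCaseMADerandomization.lean`;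
`MAScale.exists_NTIME_of_referee`, `PromiseMAScaling.lean`), and so is Arthur of item 2
(`PCPCkt.artF`, `PCPCircuitArthur.lean`). This file proves items 2–3, i.e. **Lemma 3.7 relative to
Theorem 3.3 alone**, the latter stated for `E` in the tree's model of nonadaptive PCP verifiers
(`PCPVerifier`, `PCP.lean`) as the single inline hypothesis

  `hPCP : ∀ A ∈ E, ∃ (V : PCPVerifier) (P : {0,1}* → {0,1}*) (p : ℕ[X]), V.IsPolyTime ∧`
  `  (∀ n, V.coins n = p(n)) ∧ P ∈ FE ∧ (∀ x ∈ A, Pr_ρ[V^{π_x}(x; ρ) accepts] = 1) ∧`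
  `  (∀ x ∉ A, ∀ π, Pr_ρ[V^π(x; ρ) accepts] ≤ 1/2)`, with `π_x(i) = (P x)[i]` (bit `i`, `false` past the end):

a polynomial-time verifier run with exactly `p(n)` coins for a polynomial `p` (the exact-count
convention of `PCPExact`; the proof LENGTH is what is `2^{O(n)}`, through `P ∈ FE`), perfect
completeness with respect to a proof string computable in time `2^{O(n)}`
(`FE`, `ExpTimeMaps.lean`), soundness error `1/2` — Thm. 3.3 for deterministic time `2^{O(n)}` with
`ε = 1` (no named fact is introduced, D-0026; the hypothesis is the theorem of [BFLS91]/[PS94], resp.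
of Babai–Fortnow–Lund's `MIP = NEXP` scaled down, whose algebra is being vendored separately).

* `BFPpcp.proofLang P` — the proof-bit language `{⟨x, u⟩ | π_x(⟦u⟧) = 1}` (`⟦u⟧` the little-endian
  value of `u`, any padding), in `E` for `P ∈ FE` (`proofLang_mem_E`);
* `BFPpcp.proofOf_desc_eq` — a circuit for the slice of `proofLang P` at length `2n + 2 + t`,
  `2^t ≥ |P x|`, describes exactly the proof `π_x` (through `PCPCkt.proofOf`);
* `BFPpcp.uniformProb_two_runs` — two runs on disjoint coin blocks multiply acceptance probabilities;
* **`BFP_lemma37_of_pcp`** — Lemma 3.7 from `hPCP` and `pr-MA ⊆ pr-NP`: for `A ∈ E` some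
  `B ∈ NTIME(2ⁿ)` agrees with `A` at infinitely many lengths, provided every language in `E` has
  `2^{εn}`-size circuits infinitely often for every `ε > 0` (the good lengths `m` of the proof
  language serve the input lengths `n = ⌊(m - 2 - c₁)/(c₁ + 2)⌋`; Merlin's message is
  `⟨0ᵗ, ⟨desc C, pad⟩⟩`; the exponent `ε = 1/(8 d K)` is chosen after the scaling exponent `d`);
* **`BFP_lemma37_of_pcp_of_DistNP`** — the same in the exact shape of `h37` (Köbler–Schuler under
  `DistNP ⊆ AvgP`), whence **`BuhrmanFortnowPavan2004_PromiseBPP'_subset_PromiseP_of_pcp`**,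
  **`exists_hard_E_of_DistNP_subset_AvgP_of_pcp`**, and the same under Hirahara's hypothesis
  `coNP × {U, T} ⊆ Avg¹_{1-n^{-c}}P` (**`Hirahara2021_lemma37_of_pcp`**).

## References

* H. Buhrman, L. Fortnow, A. Pavan, *Some results on derandomization*, Theory Comput. Syst. 38
  (2005) 211–227: Thm. 3.3, Lemma 3.4, Lemma 3.7 and their proofs, proof of Thm. 3.1 (authors'
  version pp. 4–6, text checked) [BuhrmanFortnowPavan2004].
* L. Babai, L. Fortnow, L. Levin, M. Szegedy, *Checking computations in polylogarithmic time*,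
  STOC 1991 [BFLS91]; A. Polishchuk, D. Spielman, *Nearly-linear size holographic proofs*, STOC 1994.
* J. Köbler, R. Schuler, *Average-case intractability vs. worst-case intractability*, Inform. and
  Comput. 190 (2004) [KoblerSchuler2004].
* S. Hirahara, ECCC TR21-058 (2021), Lemma 3.4, proof sketch items 2–3 (p. 20) [Hirahara2021].
-/

noncomputable section

namespace Literature.Computability.MetaComplexity

open _root_.Computability Polynomial Complexity Complexity.Brick Filter

namespace BFPpcp

/-! ### Arithmetic -/

/-- `|bin k| ≤ t ↔ k < 2ᵗ`. [folklore] -/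
theorem length_encodeNat_le_iff {k t : ℕ} : (encodeNat k).length ≤ t ↔ k < 2 ^ t := by
  rw [TM2Pass.length_encodeNat_eq_size, Nat.size_le]

/-- Polynomial versus exponential: `α (q+1)ᵏ ≤ 2^q` for all large `q`. [folklore] -/
theorem exists_pow_le_two_pow (α k : ℕ) : ∃ Q₀ : ℕ, ∀ q : ℕ, Q₀ ≤ q → α * (q + 1) ^ k ≤ 2 ^ q := by
  have h := tendsto_pow_const_div_const_pow_of_one_lt k (one_lt_two : (1 : ℝ) < 2)
  have hpos : (0 : ℝ) < 1 / (2 ^ k * α + 1) := by positivity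
  obtain ⟨Q₀, hQ₀⟩ := Filter.eventually_atTop.1 (h.eventually (gt_mem_nhds hpos))
  refine ⟨max Q₀ 1, fun q hq => ?_⟩
  have hq1 : 1 ≤ q := le_of_max_le_right hq
  have h1 : (q : ℝ) ^ k / 2 ^ q < 1 / (2 ^ k * α + 1) := hQ₀ q (le_of_max_le_left hq)
  have h2 : (0 : ℝ) < 2 ^ q := by positivity
  rw [div_lt_div_iff₀ h2 (by positivity), one_mul] at h1
  have h3 : (α : ℝ) * (q + 1) ^ k ≤ (q : ℝ) ^ k * (2 ^ k * α + 1) := by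
    have hq' : (q : ℝ) + 1 ≤ 2 * q := by
      have : (1 : ℝ) ≤ q := by exact_mod_cast hq1
      linarith
    have hα : (0 : ℝ) ≤ α := Nat.cast_nonneg _
    have hpk : ((q : ℝ) + 1) ^ k ≤ (2 * q) ^ k := pow_le_pow_left₀ (by positivity) hq' k
    calc (α : ℝ) * (q + 1) ^ k ≤ α * (2 * q) ^ k := mul_le_mul_of_nonneg_left hpk hα
      _ = (q : ℝ) ^ k * (2 ^ k * α) := by rw [mul_pow]; ring
      _ ≤ (q : ℝ) ^ k * (2 ^ k * α + 1) := by
        have : (0 : ℝ) ≤ (q : ℝ) ^ k := by positivity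
        nlinarith
  have h4 : (α : ℝ) * (q + 1) ^ k < 2 ^ q := h3.trans_lt h1
  exact_mod_cast h4.le

/-- `Λ (n+1)ᵏ ≤ 2^{⌊n/j⌋}` for all large `n`. [folklore] -/
theorem exists_pow_le_two_pow_div (Λ k j : ℕ) (hj : 0 < j) :
    ∃ N : ℕ, ∀ n : ℕ, N ≤ n → Λ * (n + 1) ^ k ≤ 2 ^ (n / j) := by
  obtain ⟨Q₀, hQ₀⟩ := exists_pow_le_two_pow (Λ * j ^ k) k
  refine ⟨j * Q₀, fun n hn => ?_⟩
  have hqQ : Q₀ ≤ n / j := (Nat.le_div_iff_mul_le hj).2 (by rw [mul_comm]; exact hn)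
  have hn1 : n + 1 ≤ j * (n / j + 1) := by
    have h1 := Nat.div_add_mod n j
    have h2 := Nat.mod_lt n hj
    rw [mul_add, mul_one]; omega
  calc Λ * (n + 1) ^ k ≤ Λ * (j * (n / j + 1)) ^ k := Nat.mul_le_mul_left _ (Nat.pow_le_pow_left hn1 k)
    _ = Λ * j ^ k * (n / j + 1) ^ k := by rw [mul_pow]; ring
    _ ≤ 2 ^ (n / j) := hQ₀ _ hqQ

/-- `Λ (n+1)² ≤ 2^{⌊n/k⌋}` for all large `n`. [folklore] -/
theorem exists_sq_le_two_pow_div (Λ k : ℕ) (hk : 0 < k) :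
    ∃ N : ℕ, ∀ n : ℕ, N ≤ n → Λ * (n + 1) ^ 2 ≤ 2 ^ (n / k) :=
  exists_pow_le_two_pow_div Λ 2 k hk

/-- **The input lengths served by a good length of the proof-bit language**: `m ≥ (c₁+2)(M+1)+c₁+2`
splits as `m = 2n + 2 + t` with `n > M`, `t ≥ c₁ n + c₁` and `m ≤ (2c₁+4)(n+1)`. [folklore] -/
theorem served_length (c₁ m M : ℕ) (hm : (c₁ + 2) * (M + 1) + 2 + c₁ ≤ m) :
    ∃ n t : ℕ, M + 1 ≤ n ∧ 2 * n + 2 + t = m ∧ c₁ * n + c₁ ≤ t ∧ m ≤ (2 * c₁ + 4) * (n + 1) := by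
  have hc2 : 0 < c₁ + 2 := by omega
  obtain ⟨L, hLm⟩ : ∃ L, L + 2 + c₁ = m := ⟨m - 2 - c₁, by omega⟩
  obtain ⟨q, r, hqr, hr⟩ : ∃ q r, L = (c₁ + 2) * q + r ∧ r < c₁ + 2 :=
    ⟨L / (c₁ + 2), L % (c₁ + 2), (Nat.div_add_mod L (c₁ + 2)).symm, Nat.mod_lt _ hc2⟩
  have hM : (c₁ + 2) * (M + 1) ≤ (c₁ + 2) * q + r := by omega
  have hMq : M + 1 ≤ q := by
    by_contra h
    have hq : q ≤ M := by omega
    have := Nat.mul_le_mul_left (c₁ + 2) hq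
    nlinarith
  have e1 : (c₁ + 2) * q = c₁ * q + 2 * q := by ring
  have e2 : (2 * c₁ + 4) * (q + 1) = 2 * (c₁ * q) + 4 * q + 2 * c₁ + 4 := by ring
  refine ⟨q, L - 2 * q + c₁, hMq, ?_, ?_, ?_⟩
  · omega
  · omega
  · omega

/-- Exponent bookkeeping: `2(⌊(n+1)/8d⌋ + 1) ≤ ⌊(n+1)/4d⌋ + 2`. [folklore] -/
theorem two_mul_u_le (n d : ℕ) : 2 * ((n + 1) / (8 * d) + 1) ≤ (n + 1) / (4 * d) + 2 := by
  have : (n + 1) / (8 * d) = (n + 1) / (4 * d) / 2 := by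
    rw [Nat.div_div_eq_div_mul, show 4 * d * 2 = 8 * d by ring]
  omega

/-- Exponent bookkeeping: `⌊n/2d⌋ + ⌊(n+1)/4d⌋ + 2 ≤ ⌊n/d⌋ + 3`. [folklore] -/
theorem exp_le (n d : ℕ) (hd : 0 < d) : n / (2 * d) + ((n + 1) / (4 * d) + 2) ≤ n / d + 3 := by
  obtain ⟨X, hX⟩ : ∃ X, X = n / d := ⟨_, rfl⟩
  have e1 : n / (2 * d) = X / 2 := by rw [hX, Nat.div_div_eq_div_mul, mul_comm]
  have e2 : (n + 1) / (4 * d) ≤ n / (4 * d) + 1 :=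
    (Nat.div_le_div_right (by omega : n + 1 ≤ n + 4 * d)).trans
      (by rw [Nat.add_div_right _ (by omega : 0 < 4 * d)])
  have e3 : n / (4 * d) = X / 4 := by rw [hX, Nat.div_div_eq_div_mul, mul_comm]
  rw [e3] at e2
  rw [e1, ← hX]
  omega

/-- The description-length bound in terms of the served length. [folklore] -/
theorem desc_bound (m sz u K n : ℕ) (hsz : sz ≤ 2 ^ u) (hm : m ≤ K * (n + 1)) :
    18 * (m + sz + 1) ^ 2 ≤ 18 * ((K + 2) * (n + 1) * 2 ^ u) ^ 2 := by
  refine Nat.mul_le_mul_left _ (Nat.pow_le_pow_left ?_ 2)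
  have h1 : 1 ≤ 2 ^ u := Nat.one_le_two_pow
  have h2 : K * (n + 1) ≤ K * (n + 1) * 2 ^ u := Nat.le_mul_of_pos_right _ (by omega)
  have h3 : 2 ^ u ≤ (n + 1) * 2 ^ u := Nat.le_mul_of_pos_left _ (by omega)
  have h4 : 1 ≤ (n + 1) * 2 ^ u := h1.trans h3
  calc m + sz + 1 ≤ K * (n + 1) * 2 ^ u + (n + 1) * 2 ^ u + (n + 1) * 2 ^ u := by omega
    _ = (K + 2) * (n + 1) * 2 ^ u := by ring

/-- **Merlin's message fits into `2^{⌊n/d⌋}` bits** once `Λ (n+1)² ≤ 2^{⌊n/2d⌋}`. [folklore] -/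
theorem message_fits (K d n : ℕ) (hd : 0 < d)
    (hbig : 8 * (2 * K + 36 * (K + 2) ^ 2 + 8) * (n + 1) ^ 2 ≤ 2 ^ (n / (2 * d))) :
    2 * (K * (n + 1)) + 2 * (18 * ((K + 2) * (n + 1) * 2 ^ ((n + 1) / (8 * d) + 1)) ^ 2) + 4 ≤ 2 ^ (n / d) := by
  set u := (n + 1) / (8 * d) + 1 with hu
  have hu2 : 2 * u ≤ (n + 1) / (4 * d) + 2 := two_mul_u_le n d
  have hsq : ((K + 2) * (n + 1) * 2 ^ u) ^ 2 = (K + 2) ^ 2 * (n + 1) ^ 2 * 2 ^ (2 * u) := by ring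
  rw [hsq]
  have h4u : 2 ^ (2 * u) ≤ 2 ^ ((n + 1) / (4 * d) + 2) := Nat.pow_le_pow_right (by norm_num) hu2
  have h1' : 1 ≤ 2 ^ (2 * u) := Nat.one_le_two_pow
  have hn2 : n + 1 ≤ (n + 1) ^ 2 := by nlinarith
  have hL : 2 * (K * (n + 1)) + 2 * (18 * ((K + 2) ^ 2 * (n + 1) ^ 2 * 2 ^ (2 * u))) + 4 ≤
      (2 * K + 36 * (K + 2) ^ 2 + 8) * (n + 1) ^ 2 * 2 ^ (2 * u) := by
    have a1 : 2 * (K * (n + 1)) ≤ 2 * K * (n + 1) ^ 2 * 2 ^ (2 * u) := by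
      calc 2 * (K * (n + 1)) = 2 * K * (n + 1) * 1 := by ring
        _ ≤ 2 * K * (n + 1) ^ 2 * 2 ^ (2 * u) := Nat.mul_le_mul (Nat.mul_le_mul_left _ hn2) h1'
    have a2 : 4 ≤ 8 * (n + 1) ^ 2 * 2 ^ (2 * u) := by
      have : 1 ≤ (n + 1) ^ 2 * 2 ^ (2 * u) := Nat.le_mul_of_pos_left _ (by positivity) |>.trans' h1'
      nlinarith
    have a3 : 2 * (18 * ((K + 2) ^ 2 * (n + 1) ^ 2 * 2 ^ (2 * u))) = 36 * (K + 2) ^ 2 * (n + 1) ^ 2 * 2 ^ (2 * u) := by ring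
    nlinarith
  refine hL.trans ?_
  have h8 : 8 * ((2 * K + 36 * (K + 2) ^ 2 + 8) * (n + 1) ^ 2 * 2 ^ (2 * u)) ≤ 8 * 2 ^ (n / d) := by
    calc 8 * ((2 * K + 36 * (K + 2) ^ 2 + 8) * (n + 1) ^ 2 * 2 ^ (2 * u))
        = (8 * (2 * K + 36 * (K + 2) ^ 2 + 8) * (n + 1) ^ 2) * 2 ^ (2 * u) := by ring
      _ ≤ 2 ^ (n / (2 * d)) * 2 ^ ((n + 1) / (4 * d) + 2) := Nat.mul_le_mul hbig h4u
      _ = 2 ^ (n / (2 * d) + ((n + 1) / (4 * d) + 2)) := by rw [← pow_add]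
      _ ≤ 2 ^ (n / d + 3) := Nat.pow_le_pow_right (by norm_num) (exp_le n d hd)
      _ = 8 * 2 ^ (n / d) := by rw [pow_add]; ring
  omega


/-- **A polynomial coin count fits twice into `2^{⌊n/d⌋}` bits** for all large `n`. [folklore] -/
theorem exists_two_mul_eval_le (p : Polynomial ℕ) (d : ℕ) (hd : 0 < d) :
    ∃ N : ℕ, ∀ n : ℕ, N ≤ n → 2 * p.eval n ≤ 2 ^ (n / d) := by
  obtain ⟨a, ℓ₁, ha⟩ := MAScale.exists_pow_ge_eval p
  obtain ⟨N, hN⟩ := exists_pow_le_two_pow_div 2 a d hd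
  refine ⟨max ℓ₁ N, fun n hn => ?_⟩
  have h1 : p.eval n ≤ n ^ a := ha n (le_of_max_le_left hn)
  have h2 : n ^ a ≤ (n + 1) ^ a := Nat.pow_le_pow_left (Nat.le_succ n) a
  have h3 := hN n (le_of_max_le_right hn)
  omega

/-! ### The proof-bit language -/

/-- The bit lookup `⟨T, u⟩ ↦ (T↓min(⟦u⟧,|T|))↾1` (`binToUnaryFn` + `bitAtFn`). [folklore] -/
def lookF : List Bool → List Bool := bitAtFn ∘ fanoutFn binToUnaryFn fstF

/-- Value of the bit lookup on a pair. [folklore] -/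
theorem lookF_boolPair (T u : List Bool) :
    lookF (boolPair T u) = (T.drop (min (bitsToNat u) T.length)).take 1 := by
  simp [lookF, ones]

/-- `lookF ∈ FP`. [folklore] -/
theorem lookF_mem_FP : lookF ∈ FP :=
  comp_mem_FP bitAtFn_mem_FP (fanoutFn_mem_FP binToUnaryFn_mem_FP fstF_mem_FP)

/-- The head of `(T↓min(i,|T|))↾1` is the bit `T[i]` (`false` past the end). [folklore] -/
theorem headD_take_drop_min (T : List Bool) (i : ℕ) :
    ((T.drop (min i T.length)).take 1).headD false = T.getD i false := by
  by_cases hi : i < T.length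
  · rw [min_eq_left hi.le, List.take_one_drop_eq_of_lt_length hi]
    simp [List.getD_eq_getElem?_getD, List.getElem?_eq_getElem hi]
  · rw [not_lt] at hi
    rw [min_eq_right hi, List.drop_of_length_le le_rfl]
    simp [List.getD_eq_getElem?_getD, List.getElem?_eq_none_iff.2 hi]

/-- The language of words with head bit `1`. [folklore] -/
def headLang : Language Bool := {w | w.headD false = true}

/-- `headLang ∈ P` (the head-bit brick). [folklore] -/
theorem headLang_mem_P : headLang ∈ Classes.P :=
  mem_P_of_mem_FP HashBricks.headBitFn_mem_FP headLang fun w =>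
    ⟨fun h => by rw [HashBricks.headBitFn_apply]; exact congrArg (fun b => [b]) h,
     fun h => by
      rw [HashBricks.headBitFn_apply]
      have h' : ¬ (w.headD false = true) := h
      rw [Bool.not_eq_true] at h'
      rw [h']⟩

/-- **The proof-bit language** of a proof function `P`: `⟨x, u⟩ ↦ π_x(⟦u⟧)`, `π_x(i) = (P x)[i]`
(`false` past the end), `⟦u⟧` the little-endian value of `u` (so every padding of an address is
accepted). Formally the preimage of `headLang` under `lookF ∘ mapFstFn P`.
[cite: BuhrmanFortnowPavan2004, Lemma 3.4 (proof: "this proof can be described by a circuit")] -/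
def proofLang (P : List Bool → List Bool) : Language Bool := (lookF ∘ mapFstFn P) ⁻¹' headLang

/-- Membership of a pair in the proof-bit language. [folklore] -/
theorem boolPair_mem_proofLang (P : List Bool → List Bool) (x u : List Bool) :
    boolPair x u ∈ proofLang P ↔ (P x).getD (bitsToNat u) false = true := by
  show ((lookF (mapFstFn P (boolPair x u))).headD false = true) ↔ _
  rw [mapFstFn_boolPair, lookF_boolPair, headD_take_drop_min]

/-- **`proofLang P ∈ E` for `P ∈ FE`.** [cite: BuhrmanFortnowPavan2004, Thm. 3.3 ("computable in time `t^{1+ε}(n)`")] -/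
theorem proofLang_mem_E {P : List Bool → List Bool} (hP : P ∈ FE) : proofLang P ∈ E :=
  preimage_mem_E (comp_mem_FE lookF_mem_FP (mapFstFn_mem_FE hP)) headLang_mem_P

/-! ### The proof described by a circuit for a slice of the proof-bit language -/

/-- The evaluator on a description of a `B₂`-circuit for `m` inputs, at a word of length `m`
computing a slice of `L`: the bit `[w ∈ L]`. [cite: AroraBarakCC2009, Thm. 6.18 (proof)] -/
theorem evalFn_desc_of_length_eq {m : ℕ} (C : Circuit (Fin m)) (hC : ∀ g ∈ C.gates, g.arity ≤ 2)
    {L : Language Bool} (hL : C.Computes (L.sliceFn m)) (w : List Bool) (hw : w.length = m) :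
    CircEval.evalFn (boolPair w (CircEval.desc C)) = [L.boolIndicator w] := by
  subst hw
  rw [CircEval.evalFn_boolPair_desc w C hC, hL, Language.sliceFn, List.ofFn_get]

/-- The `t`-bit address of `k < 2ᵗ` has value `k`. [folklore] -/
theorem bitsToNat_coinStr {t k : ℕ} (hk : (encodeNat k).length ≤ t) :
    bitsToNat (PCPExact.coinStr t k) = k := by
  rw [PCPExact.coinStr, PCPExact.takeD_of_length_le false t _ hk, bitsToNat_append_replicate_false,
    bitsToNat_encodeNat]

/-- **A circuit for the slice of the proof-bit language describes the proof.** If `C` computes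
`proofLang P ∩ {0,1}ᵐ`, `m = 2|x| + 2 + t`, and `|P x| ≤ 2ᵗ`, then the proof read off `desc C` with
address width `t` is `π_x` itself. [cite: BuhrmanFortnowPavan2004, Lemma 3.4 (proof)] -/
theorem proofOf_desc_eq {P : List Bool → List Bool} {x v : List Bool} {m : ℕ} (C : Circuit (Fin m))
    (hCB : C.IsOver B2) (hCc : C.Computes ((proofLang P).sliceFn m))
    (hm : 2 * x.length + 2 + v.length = m) (hPx : (P x).length ≤ 2 ^ v.length) :
    PCPCkt.proofOf x v (CircEval.desc C) = fun k => (P x).getD k false := by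
  funext k
  by_cases hk : (encodeNat k).length ≤ v.length
  · rw [PCPCkt.proofOf_of_length_le hk,
      evalFn_desc_of_length_eq C (fun g hg => hCB g hg) hCc _ (by rw [length_boolPair]; simp [hm])]
    show (Set.boolIndicator (proofLang P) (boolPair x (PCPExact.coinStr v.length k))) = _
    have hmem := boolPair_mem_proofLang P x (PCPExact.coinStr v.length k)
    rw [bitsToNat_coinStr hk] at hmem
    rw [Bool.eq_iff_iff, ← hmem]
    exact (Set.mem_iff_boolIndicator _ _).symm
  · rw [not_le] at hk
    rw [PCPCkt.proofOf_of_lt_length hk]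
    have hk' : 2 ^ v.length ≤ k := by
      by_contra h
      exact absurd (length_encodeNat_le_iff.2 (not_le.1 h)) (not_le.2 hk)
    rw [List.getD_eq_default _ _ (hPx.trans hk')]

/-! ### Two runs on disjoint coin blocks -/

/-- **Two runs on disjoint coin blocks multiply**: for `ℓ ≥ 2r`,
`Pr_{z ∈ {0,1}^ℓ}[Q(z↾r) ∧ Q((z↓r)↾r)] = Pr_ρ[Q ρ]²`. [cite: AroraBarakCC2009, §7.4.1] -/
theorem uniformProb_two_runs {r ℓ : ℕ} (hℓ : 2 * r ≤ ℓ) (Q : List Bool → Bool) :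
    uniformProb ℓ {z | (Q (z.takeD r false) && Q ((z.drop r).takeD r false)) = true} =
      uniformProb r {ρ | Q ρ = true} * uniformProb r {ρ | Q ρ = true} := by
  obtain ⟨b, rfl⟩ : ∃ b, ℓ = r + b := ⟨ℓ - r, by omega⟩
  have hrb : r ≤ b := by omega
  have h1 : uniformProb (r + b) {z | (Q (z.takeD r false) && Q ((z.drop r).takeD r false)) = true} =
      uniformProb (r + b) {z | z.take r ∈ {ρ | Q ρ = true} ∧ z.drop r ∈ {w | w.take r ∈ {ρ | Q ρ = true}}} := by
    refine uniformProb_congr_two fun z hz => ?_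
    have ht1 : z.takeD r false = z.take r := List.takeD_eq_take _ (by omega)
    have ht2 : (z.drop r).takeD r false = (z.drop r).take r :=
      List.takeD_eq_take _ (by rw [List.length_drop]; omega)
    simp [ht1, ht2, Bool.and_eq_true]
  rw [h1, uniformProb_eq_cnt_div, cnt_take_drop]
  have hF : ((cnt b {w : List Bool | w.take r ∈ {ρ : List Bool | Q ρ = true}} : ℕ) : ℝ) / 2 ^ b =
      uniformProb r {ρ | Q ρ = true} := by
    rw [← uniformProb_eq_cnt_div]; exact uniformProb_take_of_le hrb _
  have hE : ((cnt r {ρ : List Bool | Q ρ = true} : ℕ) : ℝ) / 2 ^ r = uniformProb r {ρ | Q ρ = true} :=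
    (uniformProb_eq_cnt_div _ _).symm
  calc ((cnt r {ρ : List Bool | Q ρ = true} * cnt b {w : List Bool | w.take r ∈ {ρ : List Bool | Q ρ = true}} : ℕ) : ℝ) /
        2 ^ (r + b)
      = ((cnt r {ρ : List Bool | Q ρ = true} : ℕ) : ℝ) / 2 ^ r *
          (((cnt b {w : List Bool | w.take r ∈ {ρ : List Bool | Q ρ = true}} : ℕ) : ℝ) / 2 ^ b) := by
        rw [Nat.cast_mul, pow_add, div_mul_div_comm]
    _ = _ := by rw [hE, hF]
where
  /-- Congruence of `uniformProb` on strings of the right length. [folklore] -/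
  uniformProb_congr_two {n : ℕ} {E E' : Set (List Bool)}
      (h : ∀ u : List Bool, u.length = n → (u ∈ E ↔ u ∈ E')) : uniformProb n E = uniformProb n E' := by
    rw [uniformProb_eq_cnt_div, uniformProb_eq_cnt_div, cnt_congr h]

/-! ### The description length -/

/-- `|desc C| ≤ 18 (m + |C| + 1)²`. [cite: AroraBarakCC2009, Thm. 6.18 (proof)] -/
theorem length_desc_le_sq {m : ℕ} (C : Circuit (Fin m)) :
    (CircEval.desc C).length ≤ 18 * (m + C.size + 1) ^ 2 := by
  refine (CircEval.length_desc_le C).trans ?_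
  have h1 : C.size + 1 ≤ m + C.size + 1 := by omega
  have h2 : 8 * (m + C.size) + 10 ≤ 18 * (m + C.size + 1) := by omega
  calc (C.size + 1) * (8 * (m + C.size) + 10) ≤ (m + C.size + 1) * (18 * (m + C.size + 1)) :=
        Nat.mul_le_mul h1 h2
    _ = 18 * (m + C.size + 1) ^ 2 := by ring

end BFPpcp

open BFPpcp

/-! ### Lemma 3.7 from Theorem 3.3 -/

/-- **Buhrman–Fortnow–Pavan, Lemma 3.7, from their Thm. 3.3 (PCPs for `E`) and `pr-MA ⊆ pr-NP`.**
If every `A ∈ E` has a polynomial-time nonadaptive PCP verifier with `c n + c` coins, perfect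
completeness for a proof computable in time `2^{O(n)}` and soundness error `1/2` (`hPCP`, BFP's
Thm. 3.3 = [BFLS91, PS94] for deterministic time `2^{O(n)}`), if `pr-MA ⊆ pr-NP` (`hMA`, Köbler–Schuler
under the average-case hypothesis), and if every language in `E` has circuits of size `2^{εn}` at
infinitely many lengths for every `ε > 0` (`hio`), then every `A ∈ E` agrees with some `B ∈ NTIME(2ⁿ)`
on all inputs of infinitely many lengths. Proof as printed (Lemma 3.4: Merlin sends a small circuit
for the proof-bit language `proofLang P ∈ E` at a good length, Arthur runs the verifier — twice —
answering its queries by evaluating the circuit; then the `NTIME(2ⁿ)` simulation of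
`MAScale.exists_NTIME_of_referee`, with `ε` chosen after its exponent `d`).
[cite: BuhrmanFortnowPavan2004, Lemma 3.7 (proof) and Lemma 3.4 (proof)] -/
theorem BFP_lemma37_of_pcp
    (hPCP : ∀ A ∈ E, ∃ (V : PCPVerifier) (P : List Bool → List Bool) (p : Polynomial ℕ), V.IsPolyTime ∧
      (∀ n, V.coins n = p.eval n) ∧ P ∈ FE ∧
      (∀ x ∈ A, V.acceptProb x (fun i => (P x).getD i false) = 1) ∧
      (∀ x ∉ A, ∀ π : ℕ → Bool, V.acceptProb x π ≤ 1 / 2))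
    (hMA : PromiseMA' ⊆ PromiseNP)
    (hio : ∀ A ∈ E, ∀ ε : ℝ, 0 < ε → ∃ᶠ n : ℕ in atTop, (A.circuitSize n : ℝ) ≤ (2 : ℝ) ^ (ε * n)) :
    ∀ A ∈ E, ∃ B ∈ NTIME (fun n => 2 ^ n), ∃ᶠ n : ℕ in atTop,
      ∀ x : List Bool, x.length = n → (x ∈ A ↔ x ∈ B) := by
  classical
  intro A hA
  obtain ⟨V, P, p, hV, hcoins, hP, hcompl, hsound⟩ := hPCP A hA
  -- output length of the proof function
  obtain ⟨s, ⟨c₁, hc₁⟩, -, hsl⟩ := exists_length_le_of_mem_FE hP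
  have hPlen : ∀ x : List Bool, (P x).length ≤ 2 ^ (c₁ * x.length + c₁) := fun x => (hsl x).trans (hc₁ _)
  -- the proof-bit language and the `NTIME(2ⁿ)` simulation of Arthur
  have hPiE : proofLang P ∈ E := proofLang_mem_E hP
  obtain ⟨d, ℓ, n₀, B, hd, hB, hℓ, hBspec⟩ :=
    MAScale.exists_NTIME_of_referee hMA (PCPCkt.artF_mem_FP (V := V) (p := p) hV)
  refine ⟨B, hB, ?_⟩
  -- constants: `K = 2c₁ + 4`, `ε' = 1/(8dK)`
  have hDpos : 0 < 8 * d * (2 * c₁ + 4) := by positivity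
  obtain ⟨ε', hε', hε'pos⟩ : ∃ ε' : ℝ, ε' = 1 / ((8 * d * (2 * c₁ + 4) : ℕ) : ℝ) ∧ 0 < ε' :=
    ⟨_, rfl, by positivity⟩
  have hfreq := hio _ hPiE ε' hε'pos
  obtain ⟨N₁, hN₁⟩ := exists_sq_le_two_pow_div
    (8 * (2 * (2 * c₁ + 4) + 36 * (2 * c₁ + 4 + 2) ^ 2 + 8)) (2 * d) (by omega)
  obtain ⟨N₂, hN₂⟩ := exists_two_mul_eval_le p d hd
  rw [Filter.frequently_atTop]
  intro N
  obtain ⟨M, hMN, hMn₀, hMN₁, hMN₂⟩ : ∃ M, N ≤ M ∧ n₀ ≤ M ∧ N₁ ≤ M ∧ N₂ ≤ M :=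
    ⟨N + n₀ + N₁ + N₂, by omega, by omega, by omega, by omega⟩
  obtain ⟨m, hm, hsize⟩ := (Filter.frequently_atTop.1 hfreq) ((c₁ + 2) * (M + 1) + 2 + c₁)
  -- the served input length `n` and the address width `t`
  obtain ⟨n, t, hMn, htm, htc, hmK⟩ := served_length c₁ m M hm
  refine ⟨n, by omega, fun x hx => ?_⟩
  have hxn₀ : n₀ ≤ x.length := by omega
  -- coins at length `n`
  obtain ⟨r, hr⟩ : ∃ r, r = p.eval n := ⟨_, rfl⟩
  have h2r : 2 * r ≤ ℓ n := by
    have h1 := hN₂ n (by omega)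
    have h3 := hℓ n
    omega
  have hcoinsn : V.coins x.length = r := by rw [hx, hcoins, hr]
  have hart : ∀ y z : List Bool, PCPCkt.artF V p (boolPair (boolPair x y) z) =
      [V.accepts x (PCPCkt.proofOf x (fstF y) (nthF 1 y)) (z.takeD r false) &&
        V.accepts x (PCPCkt.proofOf x (fstF y) (nthF 1 y)) ((z.drop r).takeD r false)] := fun y z => by
    rw [PCPCkt.artF_apply, hx, ← hr]
  constructor
  · -- completeness at the good length: Merlin sends a small circuit for the proof-bit language
    intro hxA
    refine (hBspec x hxn₀).1 ?_
    obtain ⟨C, hCB, hCc, hCsize⟩ := exists_circuit_size_eq_circuitSize (proofLang P) m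
    -- the size of the circuit: `≤ 2^{⌊m/(8dK)⌋ + 1} ≤ 2^{⌊(n+1)/8d⌋ + 1}`
    obtain ⟨q, hq⟩ : ∃ q, q = m / (8 * d * (2 * c₁ + 4)) := ⟨_, rfl⟩
    have hqm : ε' * m < q + 1 := by
      have h2 : m < 8 * d * (2 * c₁ + 4) * (q + 1) := by
        have h3 := Nat.div_add_mod m (8 * d * (2 * c₁ + 4))
        have h4 := Nat.mod_lt m hDpos
        rw [← hq] at h3
        rw [mul_add, mul_one]; omega
      have h1 : (m : ℝ) < ((8 * d * (2 * c₁ + 4) : ℕ) : ℝ) * (q + 1) := by exact_mod_cast h2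
      rw [hε', one_div, inv_mul_lt_iff₀ (by exact_mod_cast hDpos)]
      exact h1
    have hCsz : C.size ≤ 2 ^ (q + 1) := by
      rw [← hCsize] at hsize
      have h2 : (2 : ℝ) ^ (ε' * m) ≤ (2 : ℝ) ^ ((q + 1 : ℕ) : ℝ) :=
        Real.rpow_le_rpow_of_exponent_le one_le_two (by push_cast; exact hqm.le)
      rw [Real.rpow_natCast] at h2
      exact_mod_cast hsize.trans h2
    have hqn : q ≤ (n + 1) / (8 * d) := by
      rw [hq]
      calc m / (8 * d * (2 * c₁ + 4)) ≤ (2 * c₁ + 4) * (n + 1) / (8 * d * (2 * c₁ + 4)) :=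
            Nat.div_le_div_right hmK
        _ = (n + 1) / (8 * d) := by
          rw [show 8 * d * (2 * c₁ + 4) = (2 * c₁ + 4) * (8 * d) by ring]
          exact Nat.mul_div_mul_left _ _ (by omega)
    have hCu : C.size ≤ 2 ^ ((n + 1) / (8 * d) + 1) :=
      hCsz.trans (Nat.pow_le_pow_right (by norm_num) (by omega))
    -- the description fits into Merlin's message
    have hdesc := (length_desc_le_sq C).trans (desc_bound m C.size _ (2 * c₁ + 4) n hCu hmK)
    have hfit := message_fits (2 * c₁ + 4) d n hd (hN₁ n (by omega))
    have hyfit : 2 * t + 2 + (2 * (CircEval.desc C).length + 2) ≤ ℓ n := by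
      have h1 := hℓ n
      have h2 : t ≤ (2 * c₁ + 4) * (n + 1) := by omega
      omega
    -- Merlin's message `y = ⟨0ᵗ, ⟨desc C, pad⟩⟩`
    obtain ⟨v, hv⟩ : ∃ v : List Bool, v = List.replicate t false := ⟨_, rfl⟩
    have hvlen : v.length = t := by rw [hv, List.length_replicate]
    obtain ⟨pad, hpad⟩ : ∃ pad : List Bool,
        pad = List.replicate (ℓ n - (2 * t + 2 + (2 * (CircEval.desc C).length + 2))) false := ⟨_, rfl⟩
    have hpadlen : pad.length = ℓ n - (2 * t + 2 + (2 * (CircEval.desc C).length + 2)) := by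
      rw [hpad, List.length_replicate]
    obtain ⟨y, hy⟩ : ∃ y : List Bool, y = boolPair v (boolPair (CircEval.desc C) pad) := ⟨_, rfl⟩
    have hylen : y.length = ℓ x.length := by
      rw [hx, hy, length_boolPair, length_boolPair, hvlen, hpadlen]
      omega
    have hfst : fstF y = v := by rw [hy, fstF_boolPair]
    have hnth : nthF 1 y = CircEval.desc C := by rw [hy, nthF_succ_boolPair, nthF_zero_boolPair]
    -- the proof read off the message is the honest proof
    have hproof : PCPCkt.proofOf x v (CircEval.desc C) = fun k => (P x).getD k false := by
      refine proofOf_desc_eq C hCB hCc (by rw [hvlen, hx]; exact htm) ?_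
      rw [hvlen]
      exact (hPlen x).trans (Nat.pow_le_pow_right (by norm_num) (by rw [hx]; exact htc))
    -- every coin string is accepted
    have hall : ∀ ρ : List Bool, ρ.length = r →
        V.accepts x (fun k => (P x).getD k false) ρ = true := by
      intro ρ hρ
      have h1 := hcompl x hxA
      unfold PCPVerifier.acceptProb at h1
      rw [hcoinsn] at h1
      exact PCPExact.forall_of_uniformProb_eq_one h1 ρ hρ
    refine ⟨y, hylen, ?_⟩
    have hone : uniformProb (ℓ x.length)
        {z : List Bool | PCPCkt.artF V p (boolPair (boolPair x y) z) = [true]} = 1 := by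
      refine uniformProb_eq_one_of_forall fun z _ => ?_
      show PCPCkt.artF V p (boolPair (boolPair x y) z) = [true]
      rw [hart, hfst, hnth, hproof, hall _ (List.takeD_length _ _ _), hall _ (List.takeD_length _ _ _)]
      rfl
    rw [hone]
    norm_num
  · -- soundness (at every large length): two independent runs square the error `1/2`
    intro hxB
    by_contra hxA
    refine (hBspec x hxn₀).2 (fun y _ => ?_) hxB
    obtain ⟨π, hπ⟩ : ∃ π : ℕ → Bool, π = PCPCkt.proofOf x (fstF y) (nthF 1 y) := ⟨_, rfl⟩
    have hp : uniformProb r {ρ | V.accepts x π ρ = true} ≤ 1 / 2 := by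
      have h1 := hsound x hxA π
      unfold PCPVerifier.acceptProb at h1
      rwa [hcoinsn] at h1
    have hset : {z : List Bool | PCPCkt.artF V p (boolPair (boolPair x y) z) = [true]} =
        {z | (V.accepts x π (z.takeD r false) && V.accepts x π ((z.drop r).takeD r false)) = true} := by
      ext z
      rw [Set.mem_setOf_eq, Set.mem_setOf_eq, hart, ← hπ, List.cons.injEq]
      exact and_iff_left rfl
    rw [hx, hset, uniformProb_two_runs h2r]
    have h0 := uniformProb_nonneg r {ρ | V.accepts x π ρ = true}
    calc uniformProb r {ρ | V.accepts x π ρ = true} * uniformProb r {ρ | V.accepts x π ρ = true}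
        ≤ (1 / 2 : ℝ) * (1 / 2) := mul_le_mul hp hp h0 (by norm_num)
      _ ≤ 1 / 3 := by norm_num

/-! ### Corollaries: `h37` and Buhrman–Fortnow–Pavan's Thm. 3.1 from Thm. 3.3 -/

/-- `pr-MA ⊆ pr-NP` under `DistNP ⊆ AvgP` (Köbler–Schuler through Hirahara's p. 9 remark
`DistNP ⊆ AvgP ⟹ coNP × {U, T} ⊆ Avg¹_{1-1/n}P`). [cite: BuhrmanFortnowPavan2004, Thm. 3.6]
[cite: Hirahara2021, Lemma 3.4 (proof sketch, item 2) and p. 9] -/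
theorem PromiseMA'_subset_PromiseNP_of_DistNP_subset_AvgP (hD : DistNP ⊆ AvgP) : PromiseMA' ⊆ PromiseNP :=
  PromiseMA'_subset_PromiseNP_of_uniform (distClass_coNP_uniform_subset_Avg1DeltaP_of_weak
    ⟨1, distClass_coNP_subset_Avg1DeltaP_of_DistNP_subset_AvgP hD one_ne_zero⟩)

/-- **Buhrman–Fortnow–Pavan, Lemma 3.7 (the tree's `h37`), from their Thm. 3.3 alone**: under
`DistNP ⊆ AvgP` (Köbler–Schuler, Thm. 3.6, giving `pr-MA ⊆ pr-NP`), if every language in `E` has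
`2^{εn}`-size circuits infinitely often for every `ε > 0` then every `A ∈ E` agrees with some
`B ∈ NTIME(2ⁿ)` at infinitely many lengths — verbatim the hypothesis `h37` of
`BuhrmanFortnowPavan2004_PromiseBPP'_subset_PromiseP_of_lemma37` and
`exists_hard_E_of_DistNP_subset_AvgP_of_lemma37` (`AvgCaseDerandomizationBFP.lean`).
[cite: BuhrmanFortnowPavan2004, Lemma 3.7 (proof), Lemma 3.4, Thm. 3.3, Thm. 3.6] -/
theorem BFP_lemma37_of_pcp_of_DistNP
    (hPCP : ∀ A ∈ E, ∃ (V : PCPVerifier) (P : List Bool → List Bool) (p : Polynomial ℕ), V.IsPolyTime ∧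
      (∀ n, V.coins n = p.eval n) ∧ P ∈ FE ∧
      (∀ x ∈ A, V.acceptProb x (fun i => (P x).getD i false) = 1) ∧
      (∀ x ∉ A, ∀ π : ℕ → Bool, V.acceptProb x π ≤ 1 / 2)) :
    DistNP ⊆ AvgP →
      (∀ A ∈ E, ∀ ε : ℝ, 0 < ε → ∃ᶠ n : ℕ in atTop, (A.circuitSize n : ℝ) ≤ (2 : ℝ) ^ (ε * n)) →
      ∀ A ∈ E, ∃ B ∈ NTIME (fun n => 2 ^ n), ∃ᶠ n : ℕ in atTop,
        ∀ x : List Bool, x.length = n → (x ∈ A ↔ x ∈ B) :=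
  fun hD hio => BFP_lemma37_of_pcp hPCP (PromiseMA'_subset_PromiseNP_of_DistNP_subset_AvgP hD) hio

/-- **Buhrman–Fortnow–Pavan, Thm. 3.1 (promise form: `DistNP ⊆ AvgP ⟹ pr-BPP = pr-P`), reduced to
their Thm. 3.3 (PCPs for `E`)**: the named fact `BuhrmanFortnowPavan2004_PromiseBPP'_subset_PromiseP`
follows from `hPCP` alone — Lemma 3.7 by `BFP_lemma37_of_pcp_of_DistNP`, the rest of the printed
proof by `BuhrmanFortnowPavan2004_PromiseBPP'_subset_PromiseP_of_lemma37`.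
[cite: BuhrmanFortnowPavan2004, Thm. 3.1 (proof), Lemma 3.7, Thm. 3.3] -/
theorem BuhrmanFortnowPavan2004_PromiseBPP'_subset_PromiseP_of_pcp
    (hPCP : ∀ A ∈ E, ∃ (V : PCPVerifier) (P : List Bool → List Bool) (p : Polynomial ℕ), V.IsPolyTime ∧
      (∀ n, V.coins n = p.eval n) ∧ P ∈ FE ∧
      (∀ x ∈ A, V.acceptProb x (fun i => (P x).getD i false) = 1) ∧
      (∀ x ∉ A, ∀ π : ℕ → Bool, V.acceptProb x π ≤ 1 / 2)) :
    BuhrmanFortnowPavan2004_PromiseBPP'_subset_PromiseP :=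
  BuhrmanFortnowPavan2004_PromiseBPP'_subset_PromiseP_of_lemma37 (BFP_lemma37_of_pcp_of_DistNP hPCP)

/-- **A `2^{εn}`-hard language in `E` from `DistNP ⊆ AvgP` and Thm. 3.3** (the body of BFP's proof
of Thm. 3.1: `exists_hard_E_of_DistNP_subset_AvgP_of_lemma37` fed with `BFP_lemma37_of_pcp_of_DistNP`).
[cite: BuhrmanFortnowPavan2004, Thm. 3.1 (proof)] -/
theorem exists_hard_E_of_DistNP_subset_AvgP_of_pcp
    (hPCP : ∀ A ∈ E, ∃ (V : PCPVerifier) (P : List Bool → List Bool) (p : Polynomial ℕ), V.IsPolyTime ∧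
      (∀ n, V.coins n = p.eval n) ∧ P ∈ FE ∧
      (∀ x ∈ A, V.acceptProb x (fun i => (P x).getD i false) = 1) ∧
      (∀ x ∉ A, ∀ π : ℕ → Bool, V.acceptProb x π ≤ 1 / 2))
    (hD : DistNP ⊆ AvgP) :
    ∃ L ∈ E, ∃ ε : ℝ, 0 < ε ∧ ∀ᶠ n : ℕ in atTop, (2 : ℝ) ^ (ε * n) ≤ (L.circuitSize n : ℝ) :=
  exists_hard_E_of_DistNP_subset_AvgP_of_lemma37 (BFP_lemma37_of_pcp_of_DistNP hPCP) hD

/-- **Lemma 3.7 under Hirahara's hypothesis `coNP × {U, T} ⊆ Avg¹_{1-n^{-c}}P`, from Thm. 3.3** — the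
shape of the hypothesis `h37` of `Hirahara2021_UP_searchUHS_of_Avg1P_of_lemma37` /
`Hirahara2021_hardE_of_lemma37` (`SearchHeuristicSchemesHardE.lean`, `LanguageCompressionHardE.lean`),
Köbler–Schuler being `Hirahara2021_PromiseMA'_subset_PromiseNP_of_Avg1P`.
[cite: Hirahara2021, Lemma 3.4 (proof sketch, items 2–3)] [cite: BuhrmanFortnowPavan2004, Lemma 3.7] -/
theorem Hirahara2021_lemma37_of_pcp
    (hPCP : ∀ A ∈ E, ∃ (V : PCPVerifier) (P : List Bool → List Bool) (p : Polynomial ℕ), V.IsPolyTime ∧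
      (∀ n, V.coins n = p.eval n) ∧ P ∈ FE ∧
      (∀ x ∈ A, V.acceptProb x (fun i => (P x).getD i false) = 1) ∧
      (∀ x ∉ A, ∀ π : ℕ → Bool, V.acceptProb x π ≤ 1 / 2)) :
    (∃ c : ℕ, distClass coNP {uniformEnsemble, tallyEnsemble} ⊆ Avg1DeltaP fun n => 1 - 1 / (n : ℝ) ^ c) →
      (∀ A ∈ E, ∀ ε : ℝ, 0 < ε → ∃ᶠ n : ℕ in atTop, (A.circuitSize n : ℝ) ≤ (2 : ℝ) ^ (ε * n)) →
      ∀ A ∈ E, ∃ B ∈ NTIME (fun n => 2 ^ n), ∃ᶠ n : ℕ in atTop,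
        ∀ x : List Bool, x.length = n → (x ∈ A ↔ x ∈ B) :=
  fun hyp hio => BFP_lemma37_of_pcp hPCP (Hirahara2021_PromiseMA'_subset_PromiseNP_of_Avg1P hyp) hio

end Literature.Computability.MetaComplexity
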